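import Summits.ResolutionOfSingularities.ResolutionOfSingularities.Theorems.CrossCutLaw2
import HarnessLib

/-!
# CrossCutLaw3 — decomp-res node «CrossCut» (lens-2 g20), file 3/3 of `CrossCutLaw`

Content VERBATIM from the decomp-res lens-2 g20 node `HOME/decomp-res-lens-2/g20/CrossCut.lean` (pin 9ac8d1ca, 4 409
l; HOME = run/shared/lean/pub/decomp-res);
CRITIC-LEDGER row 160 (+1); landing orders INBOX :600 (and lens INBOX :582): l. 112–3564 are `SpreadCut` b2959d31
VERBATIM (landed as `SpreadCutLaw…` · `SpreadCutCells` ·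
`MaxContactCutSpreadCut`) and are DELETED here with the landed modules imported instead (namespaces
`…Theorems.PinchCut` / `JetCut` / `PurityCut` / `SplitCut` / `CylinderCut` /
`SpreadCut` opened; same short names, byte-identical bodies — never two copies); NEW = §X (l. 3566–4407).  Namespace
`…Theorems.CrossCut` (the lens's `Theses.CrossCut` is
gate-reserved), sub-namespaces `Cross` / `Leaf` as in the lens (inside the re-entered `namespace Leaf` of §X.3 the
landed `…Theorems.PurityCut.Leaf` is opened so the g16
schema's short names resolve exactly as in the lens); file split only (tree files ≤ 400 lines): sections, variables,
the `open MvPolynomial` lines and every declaration exactly as in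
the lens; the node's global dupNamespace-linter line dropped.  Node files, in import order: `CrossCutLaw` (§X.0 ring
level; continued `…2`) · `CrossCutCells` (§X.2–§X.7
cone-free: the aside / port home; continued `…2`) · the wiring `MaxContactCutCrossCut` (§X BY NAME on the host
route, in the Theses cone).  All `--supports
stmt-ResolutionOfSingularities-29273` (`MaxContactCut.RungOne`); nothing closes 29273 — decided halves carry their
engines / ports as hypotheses (`CrossExit` is a paper engine);
exactly ONE located-residual aside on the lens-2 column (`Cross.CrossSpecialRung`) SUPERSEDES g19's
`Spread.SpreadSpecialRung`, re-located EXACTLY modulo the cross decided half,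
and `ComponentPackagePort` is the column's ONE port item.

§X.0 (NEW, g20): LAW (X) THE CROSS, ring level — the cross letters and chart kernels at the TANGLE point where the
δ-steep top curve meets the flank, `InsepVVKernel`; PROVED kernels, VERBATIM (continued `…2` where the 400-line cap cuts).

Part 3/3 carries: `represent_INSEPvv`, `insepVV_mem_sq_steep`, `insepVV_mem_sq_flat`, `crossShape_insepVV`.

(Sources: Hironaka1964 Ch. III; CossartJannsenSaito2020 Ch. 2, Ch. 8–9; CossartPiltant2008 Prop. 4.2;
CossartPiltant2019 Rem. 3.2; BierstoneGrigorievMilmanWlodarczyk2011 §3.1; Moh1987; Hauser2010Kangaroo; Giraud1975;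
Narasimhan1983.)
-/

open CategoryTheory AlgebraicGeometry TopologicalSpace IsLocalRing
open Literature.AlgebraicGeometry.Resolution
open Summit.ResolutionOfSingularities.ResolutionOfSingularities.Theorems
open Summit.ResolutionOfSingularities.ResolutionOfSingularities.Theorems.WeakOrderReduction
open Summit.ResolutionOfSingularities.ResolutionOfSingularities.Theorems.DeltaFaceCutClasses
open Summit.ResolutionOfSingularities.ResolutionOfSingularities.Theorems.RelativeDeltaCut
open Summit.ResolutionOfSingularities.ResolutionOfSingularities.Theorems.CurveLeafExit
open Summit.ResolutionOfSingularities.ResolutionOfSingularities.Theorems.PinchCut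
open Summit.ResolutionOfSingularities.ResolutionOfSingularities.Theorems.JetCut
open Summit.ResolutionOfSingularities.ResolutionOfSingularities.Theorems.PurityCut
open Summit.ResolutionOfSingularities.ResolutionOfSingularities.Theorems.SplitCut
open Summit.ResolutionOfSingularities.ResolutionOfSingularities.Theorems.CylinderCut
open Summit.ResolutionOfSingularities.ResolutionOfSingularities.Theorems.SpreadCut
open MvPolynomial

namespace Summit.ResolutionOfSingularities.ResolutionOfSingularities.Theorems.CrossCut

section InsepVVKernel

open MvPolynomial

/-- **INSEP-vv IN CROSS PRESENTATION** [g20; KERNEL (PROVED), characteristic 2]: `INSEP-vv = z′² + u₁⁵ + b²·u₂⁵` EXACTLY — in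
characteristic `2`, `v²u₂⁵ + u₂⁷ = (v + u₂)²·u₂⁵`: corner `z′²`, steep branch `C₁ = V(z′, u₁, u₂)` with `ε₁ = 1`, `m
= 5`, `q = 2`, flat
branch `C₂ = V(z′, u₁, b)` with `ε₂ = 1`, NO tail.  The tangle of NODE-g19 §7 is the cross letter on the nose. [folklore] -/
theorem represent_INSEPvv :
    insepVV = crossFrame 0 ^ 2 + 1 * crossFrame 1 ^ 5 + 1 * crossFrame 3 ^ 2 * crossFrame 2 ^ 5 + 0 := by
  have h2 : (2 : MvPolynomial (Fin 4) (ZMod 2)) = 0 := by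
    simpa using CharP.cast_eq_zero (MvPolynomial (Fin 4) (ZMod 2)) 2
  simp only [insepVV, crossFrame, Matrix.cons_val_zero, Matrix.cons_val_one, Matrix.head_cons, Matrix.cons_val_two,
    Matrix.tail_cons, Matrix.cons_val_three]
  linear_combination (-(X 1 * X 3 ^ 6) : MvPolynomial (Fin 4) (ZMod 2)) * h2

/-- Both branches lie in the order-`2` locus of INSEP-vv at the ring level: the member lies in the SQUARE of the
prime `(z′, u₁, u₂)` of
the steep branch …  KERNEL (PROVED). [folklore] -/
theorem insepVV_mem_sq_steep :
    insepVV ∈ (Ideal.span {crossFrame 0, crossFrame 1, crossFrame 2} : Ideal (MvPolynomial (Fin 4) (ZMod 2))) ^ 2 := by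
  rw [represent_INSEPvv]
  have h0 : crossFrame 0 ∈ (Ideal.span {crossFrame 0, crossFrame 1, crossFrame 2} :
      Ideal (MvPolynomial (Fin 4) (ZMod 2))) := Ideal.subset_span (by simp)
  have h1 : crossFrame 1 ∈ (Ideal.span {crossFrame 0, crossFrame 1, crossFrame 2} :
      Ideal (MvPolynomial (Fin 4) (ZMod 2))) := Ideal.subset_span (by simp)
  have h2 : crossFrame 2 ∈ (Ideal.span {crossFrame 0, crossFrame 1, crossFrame 2} :
      Ideal (MvPolynomial (Fin 4) (ZMod 2))) := Ideal.subset_span (by simp)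
  refine Ideal.add_mem _ (Ideal.add_mem _ (Ideal.add_mem _ ?_ ?_) ?_) (Ideal.zero_mem _)
  · exact Ideal.pow_mem_pow h0 2
  · rw [show (1 : MvPolynomial (Fin 4) (ZMod 2)) * crossFrame 1 ^ 5 = crossFrame 1 ^ 3 * crossFrame 1 ^ 2 by ring]
    exact Ideal.mul_mem_left _ _ (Ideal.pow_mem_pow h1 2)
  · rw [show (1 : MvPolynomial (Fin 4) (ZMod 2)) * crossFrame 3 ^ 2 * crossFrame 2 ^ 5 =
        (crossFrame 3 ^ 2 * crossFrame 2 ^ 3) * crossFrame 2 ^ 2 by ring]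
    exact Ideal.mul_mem_left _ _ (Ideal.pow_mem_pow h2 2)

/-- … and in the SQUARE of the prime `(z′, u₁, b)` of the flat branch: the SECOND top curve `C₂ = V(z + v², u₁, u₂ +
v)` of NODE-g19 §4
(Q4) through the core.  KERNEL (PROVED). [folklore] -/
theorem insepVV_mem_sq_flat :
    insepVV ∈ (Ideal.span {crossFrame 0, crossFrame 1, crossFrame 3} : Ideal (MvPolynomial (Fin 4) (ZMod 2))) ^ 2 := by
  rw [represent_INSEPvv]
  have h0 : crossFrame 0 ∈ (Ideal.span {crossFrame 0, crossFrame 1, crossFrame 3} :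
      Ideal (MvPolynomial (Fin 4) (ZMod 2))) := Ideal.subset_span (by simp)
  have h1 : crossFrame 1 ∈ (Ideal.span {crossFrame 0, crossFrame 1, crossFrame 3} :
      Ideal (MvPolynomial (Fin 4) (ZMod 2))) := Ideal.subset_span (by simp)
  have h3 : crossFrame 3 ∈ (Ideal.span {crossFrame 0, crossFrame 1, crossFrame 3} :
      Ideal (MvPolynomial (Fin 4) (ZMod 2))) := Ideal.subset_span (by simp)
  refine Ideal.add_mem _ (Ideal.add_mem _ (Ideal.add_mem _ ?_ ?_) ?_) (Ideal.zero_mem _)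
  · exact Ideal.pow_mem_pow h0 2
  · rw [show (1 : MvPolynomial (Fin 4) (ZMod 2)) * crossFrame 1 ^ 5 = crossFrame 1 ^ 3 * crossFrame 1 ^ 2 by ring]
    exact Ideal.mul_mem_left _ _ (Ideal.pow_mem_pow h1 2)
  · rw [show (1 : MvPolynomial (Fin 4) (ZMod 2)) * crossFrame 3 ^ 2 * crossFrame 2 ^ 5 =
        crossFrame 2 ^ 5 * crossFrame 3 ^ 2 by ring]
    exact Ideal.mul_mem_left _ _ (Ideal.pow_mem_pow h3 2)

/-- **THE CROSS LETTER HOLDS FOR INSEP-vv AT THE RING LEVEL** [g20; KERNEL (PROVED)]: with `J = (INSEP-vv)`, the cross frame and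
`q = 2` (`m = 5`): units `ε₁ = ε₂ = 1`, tail `0`, and the principal ideal is deep for BOTH weights (`z′², u₁⁵,
b²u₂⁵` have spread weight
`10 = 2m` and flank weights `4, 5, 4 ≥ 2q = 4`).  CERTIFICATE of the inhabitant's letter (the scheme-level clauses —
frame = minimal
system of the origin of `𝔸⁴`, the two primes = `curvePrime` of the two branches, `Top = C₁ ∪ C₂` open-and-closed in
itself, the flank /
spread letters at the other closed points of the branches — are read by hand in NODE-g20 §3). [folklore] -/
theorem crossShape_insepVV : CrossShape (Ideal.span {insepVV}) crossFrame 2 := by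
  refine ⟨1, 1, 0, isUnit_one, isUnit_one, Ideal.zero_mem _, ?_, ?_⟩
  · rw [← represent_INSEPvv]
    exact Ideal.subset_span rfl
  · rw [Ideal.span_singleton_le_iff_mem, represent_INSEPvv, add_zero]
    exact cross_terms_mem_crossWt crossFrame 1 1 2

end InsepVVKernel

end Summit.ResolutionOfSingularities.ResolutionOfSingularities.Theorems.CrossCut
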